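import Mathlib
import HarnessLib

/-!
# The lifted action on Rees-chart generators when the chart generator is moved by a unit

(crux stmt-ResolutionOfSingularities-15640 `WildQuotients.WildQuotientResolution`, line `Sketch`;
tower infrastructure (5′) of `L/w45c/CHAIN.md` v4 §4 row stub-2 / `W45cPlanSignaturesV4.lean` §C,
registered stub `stalkAction_chartGen_of_chart_twisted` BY NAME AND SIGNATURE;
[OURS · L1 W4.5c] — NOT a statement of any manuscript.)

Unit-twisted variant of the landed `TerminalBlowup.stalkAction_chartGen_of_chart` (p472666): in the
abstract chart setting (`ψ : R → A` with chart generators `u_l`, `ψ c_l = ψ c_i · u_l`,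
`ψ(I) ⊆ (ψ c_i)`; `S` an `A`-algebra in which `t = ψ c_i` is a non-zero-divisor; ring maps
`b : R → R`, `a : S → S` intertwined by `ι : R → S`, `a ∘ ι = ι ∘ b`), suppose the chart generator
`c_i` is moved by `b` onto a UNIT MULTIPLE modulo the chart, `ψ (b c_i) = ψ c_i · e`. Then for every
other generator `c_l` with `b c_l ∈ I` the action of `a` on the chart coordinate `u_l = c_l / c_i`
is computed inside the chart ring: `e · a(u_l) = w` for any `w` with `ψ (b c_l) = ψ c_i · w`
(`t e a(u_l) = a(t) a(u_l) = a(ι c_l) = ι(b c_l) = t w`, cancel `t`). This is the dictionary for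
the K₃ / V3 charts, where `σ x_b = x_b (1 + u)` is not invariant but a unit multiple.
-/

-- single-problem summit: the doubled namespace component `ResolutionOfSingularities` is forced
set_option linter.dupNamespace false

noncomputable section

namespace Summit.ResolutionOfSingularities.ResolutionOfSingularities.Theorems.WildQuotientResolution.TerminalBlowup

/-- **(5′) chart-generator action, unit-twisted** (variant of `stalkAction_chartGen_of_chart`
without `b c_i = c_i`): if `ψ (b c_i) = ψ c_i · e` then `a(u_l) · e = w'` for ANY `w'` with
`ψ (b c_l) = ψ c_i · w'`, and such a `w'` exists (`b c_l ∈ I`, `ψ(I) ⊆ (ψ c_i)`). Proof: with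
`t = ψ c_i` (a non-zero-divisor of `S`), `t · (a(u_l) e) = a(t u_l) = a(ι c_l) = ι(b c_l) = t w'`.
[OURS · L1 W4.5c] [folklore] -/
theorem stalkAction_chartGen_of_chart_twisted {R A S : Type} [CommRing R] [CommRing A] [CommRing S]
    {m : ℕ} (c : Fin m → R) (i : Fin m) (ψ : R →+* A) (u : {j : Fin m // j ≠ i} → A)
    (hu : ∀ j, ψ (c j.1) = ψ (c i) * u j)
    (hψI : ∀ r ∈ Ideal.span (Set.range c), ψ r ∈ Ideal.span {ψ (c i)})
    [Algebra A S] (hnzd : algebraMap A S (ψ (c i)) ∈ nonZeroDivisors S)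
    (ι : R →+* S) (hι : ∀ r, algebraMap A S (ψ r) = ι r)
    (b : R →+* R) (a : S →+* S) (hab : ∀ r, a (ι r) = ι (b r))
    (e : A) (he : ψ (b (c i)) = ψ (c i) * e) (l : {j : Fin m // j ≠ i})
    (hl : b (c l.1) ∈ Ideal.span (Set.range c)) :
    ∃ w : A, ψ (b (c l.1)) = ψ (c i) * w ∧
      ∀ w' : A, ψ (b (c l.1)) = ψ (c i) * w' →
        a (algebraMap A S (u l)) * algebraMap A S e = algebraMap A S w' := by
  obtain ⟨w, hw⟩ := Ideal.mem_span_singleton'.mp (hψI _ hl)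
  refine ⟨w, by rw [← hw, mul_comm], fun w' hw' => ?_⟩
  set t : S := algebraMap A S (ψ (c i)) with ht
  -- `a t = t · e`
  have hat : a t = t * algebraMap A S e := by
    rw [ht, hι, hab, ← hι (b (c i)), he, map_mul, hι]
  -- `t · (a u_l · e) = t · w'`
  have h1 : t * (a (algebraMap A S (u l)) * algebraMap A S e) = t * algebraMap A S w' := by
    have h2 : a (t * algebraMap A S (u l)) = t * algebraMap A S w' := by
      rw [ht, ← map_mul, ← hu l, hι, hab, ← hι, hw', map_mul]
    rw [map_mul, hat] at h2
    rw [← h2]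
    ring
  exact (mul_cancel_left_mem_nonZeroDivisors hnzd).mp h1

end Summit.ResolutionOfSingularities.ResolutionOfSingularities.Theorems.WildQuotientResolution.TerminalBlowup

end
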